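import Summits.Parity.GeneralizedHardyLittlewood.Theorems.GreenTaoLevelTwoMNTwoVerticalComponents
import Mathlib.MeasureTheory.Integral.Pi
import Mathlib.MeasureTheory.Integral.IntervalIntegral.Periodic
import HarnessLib

/-!
# Route `GreenTaoLevelTwo`, crux `MNTwo` (stmt-Parity-21276), line `birth`: smoothing along a
# central frame (the harmonic-analysis core of `stub_verticalReduction`, II)

Second half of the vertical Fourier layer of Green–Tao 2012a Lemma 3.7.  Along a central frame
`ι : ℝ^I → Z(G)` of `Y = (G/Γ, d)` (see `…MNTwoCentralFrames`, `…MNTwoVerticalComponents`) the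
SMOOTHING at scale `s` of `F : G/Γ → ℝ` is the box average
`S_s F (x) = ∫_{(ℝ/ℤ)^I} F(ι(s σ̃) · x) dσ` (`σ̃ ∈ [0,1)^I` the canonical lift).  This file proves:

* `S_s F` is `1`-bounded and `L M`-Lipschitz when `F` is `1`-bounded `M`-Lipschitz and frame
  translations are `L`-Lipschitz (`abs_smooth_le_one`, `abs_smooth_sub_smooth_le`), and
  `|S_s F − F| ≤ M L s` when translations move points by `≤ L‖t‖` (`abs_smooth_sub_self_le`);
* the MULTIPLIER IDENTITY: the vertical Fourier components of `S_s F` are those of `F` times the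
  scalar `φ_n(s) = ∫ e_n(π(s σ̃)) dσ` (`vComp_smooth`, by Fubini and the vertical-character rule
  `vComp_frame_smul`), with `|φ_n(s)| ≤ 1` (`norm_smoothMultiplier_le_one`).

(The decay `|φ_n(s)| ≤ ∏ᵢ min(1, (π s |nᵢ|)⁻¹)`, the resulting summability after two smoothings
and the assembly with `…MNTwoVerticalReductionBookkeeping` are the remaining steps.)  All
statements are definition-free; integrals over the torus are against
`Measure.pi fun _ => AddCircle.haarAddCircle` (Mathlib's normalisation, total mass `1`).

References: B. Green, T. Tao, *The Möbius function is strongly orthogonal to nilsequences*,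
Ann. of Math. 175 (2012), Lemma 3.7 (and App. A) [GreenTao2012Mobius].
-/

noncomputable section

open MeasureTheory
open Literature.NumberTheory.Sieve
open Summit.Parity.GeneralizedHardyLittlewood.GreenTaoLevelTwoMNTwoVerticalComponents

namespace Summit.Parity.GeneralizedHardyLittlewood.GreenTaoLevelTwoMNTwoVerticalSmoothing

variable {s : ℕ} (Y : Nilmanifold s) {I : Type} (ι : (I → ℝ) → Y.G)

/-! ### §1 Measurability and integrability on the torus -/

/-- The canonical lift `(ℝ/ℤ)^I → [0,1)^I ⊆ ℝ^I` is measurable. [folklore] -/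
theorem measurable_lift [Fintype I] :
    Measurable fun σ : UnitAddTorus I => fun i => (AddCircle.equivIco (1 : ℝ) 0 (σ i) : ℝ) := by
  refine measurable_pi_lambda _ fun i => ?_
  have h1 : Measurable fun c : UnitAddCircle => (AddCircle.equivIco (1 : ℝ) 0 c : ℝ) :=
    measurable_subtype_coe.comp (AddCircle.measurableEquivIco (1 : ℝ) 0).measurable
  exact h1.comp (measurable_pi_apply i)

/-- The canonical lift has coordinates in `[0, 1)`, hence sup norm `≤ 1`. [folklore] -/
theorem norm_lift_le_one [Fintype I] (σ : UnitAddTorus I) :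
    ‖(fun i => (AddCircle.equivIco (1 : ℝ) 0 (σ i) : ℝ))‖ ≤ 1 := by
  refine (pi_norm_le_iff_of_nonneg zero_le_one).mpr fun i => ?_
  have h := (AddCircle.equivIco (1 : ℝ) 0 (σ i)).2
  rw [Set.mem_Ico] at h
  have h2 : ((AddCircle.equivIco (1 : ℝ) 0 (σ i)) : ℝ) < 1 := by linarith [h.2]
  rw [Real.norm_eq_abs, abs_le]
  constructor <;> linarith [h.1, h2]

/-- The orbit map `g ↦ g · x` is continuous. [folklore] -/
theorem continuous_smul_pt (x : Y.G ⧸ Y.Γ) : Continuous fun g : Y.G => g • x := by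
  obtain ⟨g₀, rfl⟩ := QuotientGroup.mk_surjective x
  exact (QuotientGroup.continuous_mk.comp (continuous_id.mul continuous_const)).congr fun g => rfl

/-- The smoothing integrand `σ ↦ F(ι(s σ̃) · x)` is measurable (for continuous `F`, `ι`).
[folklore] -/
theorem measurable_smoothIntegrand [Fintype I] (hcont : Continuous ι) {F : Y.G ⧸ Y.Γ → ℝ}
    (hF : Continuous F) (r : ℝ) (x : Y.G ⧸ Y.Γ) :
    Measurable fun σ : UnitAddTorus I =>
      F (ι (fun i => r * (AddCircle.equivIco (1 : ℝ) 0 (σ i) : ℝ)) • x) := by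
  have hc : Continuous fun v : I → ℝ => F (ι (fun i => r * v i) • x) :=
    hF.comp ((continuous_smul_pt Y x).comp (hcont.comp (continuous_pi fun i =>
      (continuous_const.mul (continuous_apply i)))))
  exact hc.measurable.comp measurable_lift

/-- A measurable function bounded by `C` is integrable against a finite measure. [folklore] -/
theorem integrable_of_measurable_bounded {α : Type*} [MeasurableSpace α] {μ : Measure α}
    [IsFiniteMeasure μ] {f : α → ℝ} (hf : Measurable f) {C : ℝ} (hC : ∀ a, |f a| ≤ C) :
    Integrable f μ :=
  Integrable.mono' (integrable_const C) hf.aestronglyMeasurable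
    (Filter.Eventually.of_forall fun a => by rw [Real.norm_eq_abs]; exact hC a)

/-! ### §2 The smoothing `S_s F (x) = ∫ F(ι(s σ̃) · x) dσ`: boundedness, Lipschitz, closeness -/

/-- **`|S_s F| ≤ 1`** for `1`-bounded `F`. [cite: GreenTao2012Mobius, Lemma 3.7] -/
theorem abs_smooth_le_one [Fintype I] {F : Y.G ⧸ Y.Γ → ℝ} (hF : ∀ y, |F y| ≤ 1) (r : ℝ)
    (x : Y.G ⧸ Y.Γ) :
    |∫ σ : UnitAddTorus I, F (ι (fun i => r * (AddCircle.equivIco (1 : ℝ) 0 (σ i) : ℝ)) • x)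
        ∂(Measure.pi fun _ : I => AddCircle.haarAddCircle)| ≤ 1 := by
  rw [← Real.norm_eq_abs]
  refine (norm_integral_le_of_norm_le_const (C := 1) (Filter.Eventually.of_forall fun σ => ?_)).trans ?_
  · rw [Real.norm_eq_abs]; exact hF _
  · simp

/-- **`S_s F` is `L M`-Lipschitz** (`F` `M`-Lipschitz with `M ≥ 0`, frame translations
`L`-Lipschitz). [cite: GreenTao2012Mobius, Lemma 3.7] -/
theorem abs_smooth_sub_smooth_le [Fintype I] (hcont : Continuous ι) {L M : ℝ} (hM : 0 ≤ M)
    (hlip : ∀ (t : I → ℝ) (p q : Y.G ⧸ Y.Γ), Y.dist (ι t • p) (ι t • q) ≤ L * Y.dist p q)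
    {F : Y.G ⧸ Y.Γ → ℝ} (hF : Y.IsBoundedLipschitz M F) (r : ℝ) (x y : Y.G ⧸ Y.Γ) :
    |(∫ σ : UnitAddTorus I, F (ι (fun i => r * (AddCircle.equivIco (1 : ℝ) 0 (σ i) : ℝ)) • x)
        ∂(Measure.pi fun _ : I => AddCircle.haarAddCircle)) -
      ∫ σ : UnitAddTorus I, F (ι (fun i => r * (AddCircle.equivIco (1 : ℝ) 0 (σ i) : ℝ)) • y)
        ∂(Measure.pi fun _ : I => AddCircle.haarAddCircle)| ≤ L * M * Y.dist x y := by
  have hint : ∀ z : Y.G ⧸ Y.Γ, Integrable (fun σ : UnitAddTorus I =>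
      F (ι (fun i => r * (AddCircle.equivIco (1 : ℝ) 0 (σ i) : ℝ)) • z))
      (Measure.pi fun _ : I => AddCircle.haarAddCircle) := fun z =>
    integrable_of_measurable_bounded (measurable_smoothIntegrand Y ι hcont hF.continuous r z)
      (fun σ => hF.1 _)
  rw [← integral_sub (hint x) (hint y), ← Real.norm_eq_abs]
  refine (norm_integral_le_of_norm_le_const (C := L * M * Y.dist x y)
    (Filter.Eventually.of_forall fun σ => ?_)).trans ?_
  · rw [Real.norm_eq_abs]
    set t : I → ℝ := fun i => r * (AddCircle.equivIco (1 : ℝ) 0 (σ i) : ℝ)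
    calc |F (ι t • x) - F (ι t • y)| ≤ M * Y.dist (ι t • x) (ι t • y) := hF.2 _ _
      _ ≤ M * (L * Y.dist x y) := mul_le_mul_of_nonneg_left (hlip t x y) hM
      _ = L * M * Y.dist x y := by ring
  · simp

/-- **`|S_s F − F| ≤ M L s`** (`F` `M`-Lipschitz with `M ≥ 0`, frame translations move points by
`≤ L ‖t‖`, `s ≥ 0`; the lift has sup norm `≤ 1`). [cite: GreenTao2012Mobius, Lemma 3.7] -/
theorem abs_smooth_sub_self_le [Fintype I] (hcont : Continuous ι) {L M : ℝ} (hM : 0 ≤ M)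
    (hL : 0 ≤ L) (hself : ∀ (t : I → ℝ) (p : Y.G ⧸ Y.Γ), Y.dist (ι t • p) p ≤ L * ‖t‖)
    {F : Y.G ⧸ Y.Γ → ℝ} (hF : Y.IsBoundedLipschitz M F) {r : ℝ} (hr : 0 ≤ r) (x : Y.G ⧸ Y.Γ) :
    |(∫ σ : UnitAddTorus I, F (ι (fun i => r * (AddCircle.equivIco (1 : ℝ) 0 (σ i) : ℝ)) • x)
        ∂(Measure.pi fun _ : I => AddCircle.haarAddCircle)) - F x| ≤ M * L * r := by
  have hint : Integrable (fun σ : UnitAddTorus I =>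
      F (ι (fun i => r * (AddCircle.equivIco (1 : ℝ) 0 (σ i) : ℝ)) • x))
      (Measure.pi fun _ : I => AddCircle.haarAddCircle) :=
    integrable_of_measurable_bounded (measurable_smoothIntegrand Y ι hcont hF.continuous r x)
      (fun σ => hF.1 _)
  have hconst : (∫ _σ : UnitAddTorus I, F x ∂(Measure.pi fun _ : I => AddCircle.haarAddCircle)) = F x := by
    simp
  rw [← hconst, ← integral_sub hint (integrable_const _), ← Real.norm_eq_abs]
  refine (norm_integral_le_of_norm_le_const (C := M * L * r)
    (Filter.Eventually.of_forall fun σ => ?_)).trans ?_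
  · rw [Real.norm_eq_abs]
    set t : I → ℝ := fun i => r * (AddCircle.equivIco (1 : ℝ) 0 (σ i) : ℝ) with ht
    have hnt : ‖t‖ ≤ r := by
      have e : t = r • fun i => (AddCircle.equivIco (1 : ℝ) 0 (σ i) : ℝ) := by
        funext i; simp [ht]
      rw [e, norm_smul, Real.norm_eq_abs, abs_of_nonneg hr]
      exact mul_le_of_le_one_right hr (norm_lift_le_one σ)
    have h0 : F x = F ((1 : Y.G) • x) := by rw [one_smul]
    calc |F (ι t • x) - F x| ≤ M * Y.dist (ι t • x) x := by
          have := hF.2 (ι t • x) x; exact this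
      _ ≤ M * (L * ‖t‖) := mul_le_mul_of_nonneg_left (hself t x) hM
      _ ≤ M * (L * r) := mul_le_mul_of_nonneg_left (mul_le_mul_of_nonneg_left hnt hL) hM
      _ = M * L * r := by ring
  · simp

/-! ### §3 The multiplier identity: vertical components of `S_s F` -/

/-- Mathlib's Fourier coefficient on `(ℝ/ℤ)^I`, read as an integral against
`⨂ haarAddCircle` (definitional). [folklore] -/
theorem mFourierCoeff_eq_integral_pi [Fintype I] (f : UnitAddTorus I → ℂ) (n : I → ℤ) :
    UnitAddTorus.mFourierCoeff f n =
      ∫ τ, UnitAddTorus.mFourier (-n) τ • f τ ∂(Measure.pi fun _ : I => AddCircle.haarAddCircle) :=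
  rfl

/-- **`|φ_n(s)| ≤ 1`** for the smoothing multiplier `φ_n(s) = ∫ e_n(π(s σ̃)) dσ`. [folklore] -/
theorem norm_smoothMultiplier_le_one [Fintype I] (n : I → ℤ) (r : ℝ) :
    ‖∫ σ : UnitAddTorus I, UnitAddTorus.mFourier n
        (fun i => (((r * (AddCircle.equivIco (1 : ℝ) 0 (σ i) : ℝ) : ℝ)) : UnitAddCircle))
        ∂(Measure.pi fun _ : I => AddCircle.haarAddCircle)‖ ≤ 1 := by
  refine (norm_integral_le_of_norm_le_const (C := 1) (Filter.Eventually.of_forall fun σ => ?_)).trans ?_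
  · exact (norm_mFourier_apply n _).le
  · simp

/-- **Multiplier identity** (Green–Tao 2012a Lemma 3.7, smoothing step): the `n`-th vertical
component of the smoothing `S_s F` is `φ_n(s)` times that of `F`,
`(S_s F)_n(x) = (∫ e_n(π(s σ̃)) dσ) · F_n(x)` — Fubini, commuting central translations, and the
vertical-character rule `F_n(ι(u)·x) = e_n(π u) F_n(x)`. [cite: GreenTao2012Mobius, Lemma 3.7] -/
theorem vComp_smooth [Fintype I] (hadd : ∀ t u, ι (t + u) = ι t * ι u)
    (hcen : ∀ t, ι t ∈ Subgroup.center Y.G) (hΓ : ∀ n : I → ℤ, ι (fun i => (n i : ℝ)) ∈ Y.Γ)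
    (hcont : Continuous ι) {M : ℝ} {F : Y.G ⧸ Y.Γ → ℝ} (hF : Y.IsBoundedLipschitz M F)
    (x : Y.G ⧸ Y.Γ) (n : I → ℤ) (r : ℝ) :
    UnitAddTorus.mFourierCoeff
        (fun τ : UnitAddTorus I =>
          ((∫ σ : UnitAddTorus I,
              F (ι (fun i => r * (AddCircle.equivIco (1 : ℝ) 0 (σ i) : ℝ)) •
                (ι (fun i => (AddCircle.equivIco (1 : ℝ) 0 (τ i) : ℝ)) • x))
              ∂(Measure.pi fun _ : I => AddCircle.haarAddCircle) : ℝ) : ℂ)) n =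
      (∫ σ : UnitAddTorus I, UnitAddTorus.mFourier n
          (fun i => (((r * (AddCircle.equivIco (1 : ℝ) 0 (σ i) : ℝ) : ℝ)) : UnitAddCircle))
          ∂(Measure.pi fun _ : I => AddCircle.haarAddCircle)) *
        UnitAddTorus.mFourierCoeff
          (fun τ : UnitAddTorus I =>
            (F (ι (fun i => (AddCircle.equivIco (1 : ℝ) 0 (τ i) : ℝ)) • x) : ℂ)) n := by
  rw [mFourierCoeff_eq_integral_pi]
  -- push the cast and the character inside the `σ`-integral
  have e1 : ∀ τ : UnitAddTorus I, UnitAddTorus.mFourier (-n) τ •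
      ((∫ σ : UnitAddTorus I, F (ι (fun i => r * (AddCircle.equivIco (1 : ℝ) 0 (σ i) : ℝ)) • (ι (fun i => (AddCircle.equivIco (1 : ℝ) 0 (τ i) : ℝ)) • x)) ∂(Measure.pi fun _ : I => AddCircle.haarAddCircle) : ℝ) : ℂ) =
      ∫ σ : UnitAddTorus I, UnitAddTorus.mFourier (-n) τ •
        (F (ι (fun i => r * (AddCircle.equivIco (1 : ℝ) 0 (σ i) : ℝ)) • (ι (fun i => (AddCircle.equivIco (1 : ℝ) 0 (τ i) : ℝ)) • x)) : ℂ) ∂(Measure.pi fun _ : I => AddCircle.haarAddCircle) := by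
    intro τ
    rw [← integral_complex_ofReal, ← integral_smul]
  simp_rw [e1]
  -- joint measurability / integrability, then Fubini
  have hmeas : Measurable fun p : UnitAddTorus I × UnitAddTorus I =>
      F (ι (fun i => r * (AddCircle.equivIco (1 : ℝ) 0 (p.2 i) : ℝ)) • (ι (fun i => (AddCircle.equivIco (1 : ℝ) 0 (p.1 i) : ℝ)) • x)) := by
    have hc : Continuous fun q : (I → ℝ) × (I → ℝ) => F ((ι (fun i => r * q.2 i) * ι q.1) • x) :=
      hF.continuous.comp ((continuous_smul_pt Y x).comp
        ((hcont.comp (continuous_pi fun i => continuous_const.mul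
          ((continuous_apply i).comp continuous_snd))).mul (hcont.comp continuous_fst)))
    have hm : Measurable fun p : UnitAddTorus I × UnitAddTorus I =>
        ((fun i => (AddCircle.equivIco (1 : ℝ) 0 (p.1 i) : ℝ)), (fun i => (AddCircle.equivIco (1 : ℝ) 0 (p.2 i) : ℝ))) :=
      (measurable_lift.comp measurable_fst).prodMk (measurable_lift.comp measurable_snd)
    have h := hc.measurable.comp hm
    have e : (fun p : UnitAddTorus I × UnitAddTorus I =>
        F (ι (fun i => r * (AddCircle.equivIco (1 : ℝ) 0 (p.2 i) : ℝ)) • (ι (fun i => (AddCircle.equivIco (1 : ℝ) 0 (p.1 i) : ℝ)) • x))) =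
        fun p => F ((ι (fun i => r * (AddCircle.equivIco (1 : ℝ) 0 (p.2 i) : ℝ)) * ι (fun i => (AddCircle.equivIco (1 : ℝ) 0 (p.1 i) : ℝ))) • x) :=
      funext fun p => by rw [mul_smul]
    rw [e]
    exact h
  have hint : Integrable (Function.uncurry fun (τ σ : UnitAddTorus I) =>
      UnitAddTorus.mFourier (-n) τ • (F (ι (fun i => r * (AddCircle.equivIco (1 : ℝ) 0 (σ i) : ℝ)) • (ι (fun i => (AddCircle.equivIco (1 : ℝ) 0 (τ i) : ℝ)) • x)) : ℂ))
      (((Measure.pi fun _ : I => AddCircle.haarAddCircle) : Measure (UnitAddTorus I)).prod (Measure.pi fun _ : I => AddCircle.haarAddCircle)) := by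
    refine Integrable.mono' (integrable_const (1 : ℝ))
      ((((UnitAddTorus.mFourier (-n)).continuous.measurable.comp measurable_fst).smul
        (Complex.measurable_ofReal.comp hmeas)).aestronglyMeasurable)
      (Filter.Eventually.of_forall fun p => ?_)
    change ‖UnitAddTorus.mFourier (-n) p.1 • (F (ι (fun i => r * (AddCircle.equivIco (1 : ℝ) 0 (p.2 i) : ℝ)) • (ι (fun i => (AddCircle.equivIco (1 : ℝ) 0 (p.1 i) : ℝ)) • x)) : ℂ)‖ ≤ 1
    rw [norm_smul, norm_mFourier_apply, one_mul, Complex.norm_real, Real.norm_eq_abs]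
    exact hF.1 _
  rw [integral_integral_swap hint]
  -- commute the two central translations and recognise the inner integral
  have e3 : ∀ σ τ : UnitAddTorus I, F (ι (fun i => r * (AddCircle.equivIco (1 : ℝ) 0 (σ i) : ℝ)) • (ι (fun i => (AddCircle.equivIco (1 : ℝ) 0 (τ i) : ℝ)) • x)) =
      F (ι (fun i => (AddCircle.equivIco (1 : ℝ) 0 (τ i) : ℝ)) • (ι (fun i => r * (AddCircle.equivIco (1 : ℝ) 0 (σ i) : ℝ)) • x)) := by
    intro σ τ
    rw [← mul_smul, ← mul_smul, Subgroup.mem_center_iff.mp (hcen (fun i => (AddCircle.equivIco (1 : ℝ) 0 (τ i) : ℝ))) (ι (fun i => r * (AddCircle.equivIco (1 : ℝ) 0 (σ i) : ℝ)))]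
  simp_rw [e3]
  have e4 : (fun σ : UnitAddTorus I => ∫ τ : UnitAddTorus I, UnitAddTorus.mFourier (-n) τ •
      (F (ι (fun i => (AddCircle.equivIco (1 : ℝ) 0 (τ i) : ℝ)) • (ι (fun i => r * (AddCircle.equivIco (1 : ℝ) 0 (σ i) : ℝ)) • x)) : ℂ) ∂(Measure.pi fun _ : I => AddCircle.haarAddCircle)) =
      fun σ => UnitAddTorus.mFourier n (fun i => (((r * (AddCircle.equivIco (1 : ℝ) 0 (σ i) : ℝ) : ℝ)) : UnitAddCircle)) *
        UnitAddTorus.mFourierCoeff (fun τ : UnitAddTorus I => (F (ι (fun i => (AddCircle.equivIco (1 : ℝ) 0 (τ i) : ℝ)) • x) : ℂ)) n := by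
    funext σ
    have key := vComp_frame_smul Y ι hadd hcen hΓ F x n (fun i => r * (AddCircle.equivIco (1 : ℝ) 0 (σ i) : ℝ))
    rw [mFourierCoeff_eq_integral_pi] at key
    exact key
  rw [e4, integral_mul_const]

end Summit.Parity.GeneralizedHardyLittlewood.GreenTaoLevelTwoMNTwoVerticalSmoothing
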